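import Summits.ResolutionOfSingularities.ResolutionOfSingularities.Theorems.PurelyInseparableDim4ResConeLossyTiltFreeStep
import HarnessLib
import HarnessLib.Audit.Tags

/-!
# Purely inseparable four-folds — A PERMANENT NON-CHART BOUNDARY LETTER at `(p, d) = (5, 4)` FORCES THE WEIGHTS
# `e_{j_k} + e_i` (K2(p) lane, SLICE C / TAIL-D, brick (iii-α) «B∞ ledger at (5,4)»; file-holder res-dim4-p-5 g4)

[OURS · counted 0 · cell `res-dim4-pi` · K2(p) lane, slice C (desk WORD #155 sequel) · seat p-5 g4.]
Nothing here proves K2(p)/K2(5), `NoIsolatedTrap p p` or resolution of singularities in dimension ≥ 4 / char. `p`.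

SETTING: isolated above-floor witnessed `Step0 5` chain with `x^{r₀} ∣ F₀`, constant shade `4` from `k₀` (so
`o_k = |r_k| + 4`), and a letter `i` that is NEVER the chart letter and ALWAYS a boundary letter after `k₀` (the B∞
situation complementary to `hpass` of `…TiltedTail.no_pair_tail_four_five`).  No `e_G`, no pair hypothesis.
* `apply_succ_eq_zero_of_translated` — a translated non-chart letter is free at the child;
* `untranslated_of_permanent`, `degree_succ_ge_of_permanent` — `i` is never translated, keeps its weight, and
  `|r_{k+1}| ≥ |r_k|` (the chart letter receives `|r_k| − 1`, `i` keeps `≥ 1`);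
* **`degree_eq_two_of_permanent`** — hence `|r_k| = 2` for every `k ≥ k₀`: `|r| ≥ 2` above the floor, and `|r_m| ≥ 3`
  once would give `o ≥ 7 = ⌊3·5/2⌋` for ever, an upper-band run excluded by
  `BandLayers.no_isolated_chain_eventually_upper`;
* **`shape_of_permanent_boundary_letter`** — so `r_{k+1} = e_{j_k} + e_i` exactly, `b k i = 0`, for every `k ≥ k₀`:
  the B∞ tails of TAIL-D at `(5,4)` are the ORDER-`6` tails with one fixed passive boundary letter of weight `1` and
  weight `1` on the last chart letter (which must be translated whenever the chart letter changes).
[cite: CossartJannsenSaito2020, Thm. 3.14, Lemma 13.4, Thm. 13.7] [cite: HauserPerlega2019PRIMS, §2 (transform D′ of D)]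
bears_on: LADDER-RESOLUTION:D157-DOOR2 (res-dim4-pi · K2(p) = `RidgeBudget.NoAboveFloorTrap p p` · slice C, TAIL-D residual B∞).
Supports stmt-ResolutionOfSingularities-16155 (helper).
-/

set_option linter.dupNamespace false -- mandated namespace of this single-conjunct summit

noncomputable section

namespace Summit.ResolutionOfSingularities.ResolutionOfSingularities.Theorems.PIDim4

namespace ResCone

open MvPolynomial Finset
open Literature.AlgebraicGeometry.Resolution
open Literature.AlgebraicGeometry.Resolution.CentreBlowup
open Literature.AlgebraicGeometry.Resolution.Hauser2010
open Literature.AlgebraicGeometry.Resolution.HauserPerlega2019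

variable {K : Type} [Field K] [DecidableEq K]

section PermanentBoundaryLetter

/-- A translated non-chart letter is free at the child. [cite: HauserPerlega2019PRIMS, §2 (transform D′ of D)] -/
theorem apply_succ_eq_zero_of_translated {c : ℕ → State K} {j : ℕ → Fin 4} {b : ℕ → Fin 4 → K}
    (hc : ∀ k, IsIsolated 5 (c k).F ∧ Step0 5 (c k) (c (k + 1))) (hw : FreeTail.IsWitnessedChain 5 c j b)
    (hr0 : ∀ e ∈ (c 0).F.support, (c 0).r ≤ e) (hfloor : ∀ k, ordZero (c k).F ≠ 5) {k : ℕ} {i : Fin 4}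
    (hij : i ≠ j k) (hbi : b k i ≠ 0) : (c (k + 1)).r i = 0 := by
  haveI : Fact (Nat.Prime 5) := ⟨by norm_num⟩
  obtain ⟨o, ho, -, -⟩ := chain_band 5 hc hfloor k
  rw [(hw k).2.2.2.2, step_r_univ 5 (j k) (hw k).2.1 (c k) ho (IsolatedBand.isolated_chain_forall_le hc hr0 k),
    Finsupp.coe_update, Function.update_of_ne hij, Finsupp.filter_apply, if_neg hbi]

/-- **The order/weight bookkeeping at shade `4`**: `o_k = |r_k| + 4`, `5 < o_k`, and the chart letter receives
`|r_k| − 1`. [cite: HauserPerlega2019PRIMS, §2 (transform D′ of D)] -/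
theorem chart_succ_of_shade_four {c : ℕ → State K} {j : ℕ → Fin 4} {b : ℕ → Fin 4 → K}
    (hc : ∀ k, IsIsolated 5 (c k).F ∧ Step0 5 (c k) (c (k + 1))) (hw : FreeTail.IsWitnessedChain 5 c j b)
    (hr0 : ∀ e ∈ (c 0).F.support, (c 0).r ≤ e) (hfloor : ∀ k, ordZero (c k).F ≠ 5) {k : ℕ}
    (hshade : (c k).shade = ((4 : ℕ) : ℕ∞)) :
    ∃ o : ℕ, ordZero (c k).F = o ∧ o = (c k).r.degree + 4 ∧ 5 < o ∧ (c (k + 1)).r (j k) + 1 = (c k).r.degree := by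
  haveI : Fact (Nat.Prime 5) := ⟨by norm_num⟩
  obtain ⟨o, ho, h5o, -⟩ := chain_band 5 hc hfloor k
  have hrk := IsolatedBand.isolated_chain_forall_le hc hr0 k
  have hd := ordZero_sub_degree_eq_of_shade ho hshade
  have hdeg := degree_r_le ho hrk
  refine ⟨o, ho, by omega, h5o, ?_⟩
  rw [(hw k).2.2.2.2, step_r_univ 5 (j k) (hw k).2.1 (c k) ho hrk, Finsupp.coe_update, Function.update_self]
  omega

/-- A permanent non-chart boundary letter is never translated and keeps its weight. [OURS · bookkeeping]
[cite: CossartJannsenSaito2020, Thm. 3.14] -/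
theorem untranslated_of_permanent {c : ℕ → State K} {j : ℕ → Fin 4} {b : ℕ → Fin 4 → K}
    (hc : ∀ k, IsIsolated 5 (c k).F ∧ Step0 5 (c k) (c (k + 1))) (hw : FreeTail.IsWitnessedChain 5 c j b)
    (hr0 : ∀ e ∈ (c 0).F.support, (c 0).r ≤ e) (hfloor : ∀ k, ordZero (c k).F ≠ 5) {k₀ : ℕ} {i : Fin 4}
    (hji : ∀ k, k₀ ≤ k → j k ≠ i) (hbdry : ∀ k, k₀ ≤ k → 1 ≤ (c k).r i) {k : ℕ} (hk : k₀ ≤ k) :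
    b k i = 0 ∧ (c (k + 1)).r i = (c k).r i := by
  haveI : Fact (Nat.Prime 5) := ⟨by norm_num⟩
  have hbi : b k i = 0 := by
    by_contra hne
    have h0 := apply_succ_eq_zero_of_translated hc hw hr0 hfloor (hji k hk).symm hne
    have := hbdry (k + 1) (by omega)
    omega
  exact ⟨hbi, step_r_apply_of_untranslated 5 hc hw hr0 hfloor (hji k hk).symm hbi⟩

/-- **`|r|` DOES NOT DECREASE past a permanent non-chart boundary letter** (shade `4`): the chart letter gets
`|r_k| − 1` and `i` keeps `≥ 1`. [OURS] [cite: CossartJannsenSaito2020, Thm. 3.14, Lemma 13.4] -/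
theorem degree_succ_ge_of_permanent {c : ℕ → State K} {j : ℕ → Fin 4} {b : ℕ → Fin 4 → K}
    (hc : ∀ k, IsIsolated 5 (c k).F ∧ Step0 5 (c k) (c (k + 1))) (hw : FreeTail.IsWitnessedChain 5 c j b)
    (hr0 : ∀ e ∈ (c 0).F.support, (c 0).r ≤ e) (hfloor : ∀ k, ordZero (c k).F ≠ 5) {k₀ : ℕ}
    (hshade : ∀ k, k₀ ≤ k → (c k).shade = ((4 : ℕ) : ℕ∞)) {i : Fin 4}
    (hji : ∀ k, k₀ ≤ k → j k ≠ i) (hbdry : ∀ k, k₀ ≤ k → 1 ≤ (c k).r i) {k : ℕ} (hk : k₀ ≤ k) :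
    (c k).r.degree ≤ (c (k + 1)).r.degree := by
  obtain ⟨o, -, -, -, hchart⟩ := chart_succ_of_shade_four hc hw hr0 hfloor (hshade k hk)
  obtain ⟨-, hri⟩ := untranslated_of_permanent hc hw hr0 hfloor hji hbdry hk
  have hsplit := degree_eq_apply_add_apply_add_degIn (hji k hk) (c (k + 1)).r
  have := hbdry k hk
  omega

/-- **`|r_k| = 2` FOR EVER** past a permanent non-chart boundary letter at `(5,4)`: `|r| ≥ 2` above the floor
(`o = |r| + 4 > 5`), and `|r_m| ≥ 3` once would propagate (`degree_succ_ge_of_permanent`) into `o ≥ 7 = ⌊15/2⌋`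
for ever — an upper-band run, excluded by `BandLayers.no_isolated_chain_eventually_upper`. [OURS]
[cite: CossartJannsenSaito2020, Lemma 13.4, Thm. 13.7] -/
theorem degree_eq_two_of_permanent [CharP K 5] {c : ℕ → State K} {j : ℕ → Fin 4} {b : ℕ → Fin 4 → K}
    (hc : ∀ k, IsIsolated 5 (c k).F ∧ Step0 5 (c k) (c (k + 1))) (hw : FreeTail.IsWitnessedChain 5 c j b)
    (hr0 : ∀ e ∈ (c 0).F.support, (c 0).r ≤ e) (hfloor : ∀ k, ordZero (c k).F ≠ 5) {k₀ : ℕ}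
    (hshade : ∀ k, k₀ ≤ k → (c k).shade = ((4 : ℕ) : ℕ∞)) {i : Fin 4}
    (hji : ∀ k, k₀ ≤ k → j k ≠ i) (hbdry : ∀ k, k₀ ≤ k → 1 ≤ (c k).r i) {k : ℕ} (hk : k₀ ≤ k) :
    (c k).r.degree = 2 := by
  haveI : Fact (Nat.Prime 5) := ⟨by norm_num⟩
  obtain ⟨o, -, hosum, h5o, -⟩ := chart_succ_of_shade_four hc hw hr0 hfloor (hshade k hk)
  refine le_antisymm ?_ (by omega)
  by_contra h3
  push Not at h3
  -- `|r_n| ≥ 3` for every `n ≥ k`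
  have hmono : ∀ n, k ≤ n → 3 ≤ (c n).r.degree := by
    intro n hn
    induction n, hn using Nat.le_induction with
    | base => omega
    | succ n hn ih => exact ih.trans (degree_succ_ge_of_permanent hc hw hr0 hfloor hshade hji hbdry (by omega))
  refine BandLayers.no_isolated_chain_eventually_upper 5 hc (k₀ := k) fun n hn => ?_
  obtain ⟨o', ho', ho'sum, -, -⟩ := chart_succ_of_shade_four hc hw hr0 hfloor (hshade n (by omega))
  rw [ho']
  have := hmono n hn
  exact_mod_cast (show (3 * 5) / 2 ≤ o' by omega)

/-- **THE SHAPE OF A B∞ TAIL AT `(5,4)`**: past a permanent non-chart boundary letter `i` (shade `4`), every step has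
`b k i = 0` and the child's weights are EXACTLY `r_{k+1} = e_{j_k} + e_i` — weight `1` on the last chart letter, weight
`1` on `i`, nothing else (so `o ≡ 6`, and a change of chart letter must translate the previous one). [OURS]
[cite: CossartJannsenSaito2020, Thm. 3.14, Lemma 13.4, Thm. 13.7] -/
theorem shape_of_permanent_boundary_letter [CharP K 5] {c : ℕ → State K} {j : ℕ → Fin 4} {b : ℕ → Fin 4 → K}
    (hc : ∀ k, IsIsolated 5 (c k).F ∧ Step0 5 (c k) (c (k + 1))) (hw : FreeTail.IsWitnessedChain 5 c j b)
    (hr0 : ∀ e ∈ (c 0).F.support, (c 0).r ≤ e) (hfloor : ∀ k, ordZero (c k).F ≠ 5) {k₀ : ℕ}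
    (hshade : ∀ k, k₀ ≤ k → (c k).shade = ((4 : ℕ) : ℕ∞)) {i : Fin 4}
    (hji : ∀ k, k₀ ≤ k → j k ≠ i) (hbdry : ∀ k, k₀ ≤ k → 1 ≤ (c k).r i) {k : ℕ} (hk : k₀ ≤ k) :
    b k i = 0 ∧ (c (k + 1)).r = Finsupp.single (j k) 1 + Finsupp.single i 1 := by
  obtain ⟨o, -, -, -, hchart⟩ := chart_succ_of_shade_four hc hw hr0 hfloor (hshade k hk)
  obtain ⟨hbi, hri⟩ := untranslated_of_permanent hc hw hr0 hfloor hji hbdry hk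
  have h2 := degree_eq_two_of_permanent hc hw hr0 hfloor hshade hji hbdry hk
  have h2' := degree_eq_two_of_permanent hc hw hr0 hfloor hshade hji hbdry (k := k + 1) (by omega)
  have hsplit := degree_eq_apply_add_apply_add_degIn (hji k hk) (c (k + 1)).r
  have h1 := hbdry k hk
  have hrest : degIn ((Finset.univ.erase (j k)).erase i) (c (k + 1)).r = 0 := by omega
  refine ⟨hbi, ?_⟩
  ext l
  rw [two_apply (hji k hk)]
  by_cases hlj : l = j k
  · rw [if_pos hlj, hlj]; omega
  · rw [if_neg hlj]
    by_cases hli : l = i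
    · rw [if_pos hli, hli]; omega
    · rw [if_neg hli]
      exact degIn_eq_zero_iff.mp hrest l (Finset.mem_erase.mpr ⟨hli, Finset.mem_erase.mpr ⟨hlj, Finset.mem_univ l⟩⟩)

end PermanentBoundaryLetter

end ResCone

end Summit.ResolutionOfSingularities.ResolutionOfSingularities.Theorems.PIDim4

end
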